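import Summits.HodgeConjecture.CorCM.IrreducibleOddWeightsShadowModulesParityCertificate
import Summits.HodgeConjecture.CorCM.IrreducibleOddWeightsShadowModulesCMFields
import HarnessLib

/-!
# Shadow modules, X (CM fields): the PARITY CERTIFICATE for CM fields — over (IRR) CM pivots with scalar commutant, four odd
# integers read off one reference `Aut(ℂ)`-isomorphism `Anti(T₁) → Anti(T₀)` force `Hg(A₀ × A₁) = Hg(A₀) × Hg(A₁)`

COR-CM (cell `pub-hodgecm2`, binder seat `b16` gen 69, count-neutral claim ROW SPACES OVER THE COMMUTANT, file Q9b — CM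
fields; theorems only, no definition, no named fact, no `sorry`).  NEW as stated, hence under `Summits/`.  HONEST FRAMING:
file Q9 dressed for CM fields exactly as Q4 dresses Q3b; the reference map `L₀`, the scalar-commutant hypothesis and the
four odd integers are hypotheses about the finite Galois action (this generation's census supplies them for 46 positional
base pairs, `census-g69/d4block.json`); consequences for `dim MT(A₀ × A₁)` only; `HC_CM` is neither used nor asserted.

* **`cmFamilyRank_add_card_eq_of_parity_certificate`** — CM pivots `T₀ ⊆ K_{i₀}`, `T₁ ⊆ K_{i₁}` containing the traces,
  `Anti(T₀)`, `Anti(T₁)` irreducible, every `Aut(ℂ)`-equivariant endomorphism of `Anti(T₀)` a scalar; `L₀` equivariant and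
  injective on `Anti(T₁)` into `Anti(T₀)`; `v ∈ Anti(T₁)` with `L₀ v =` the shadow `w₀` of `Φ_{i₀}`; embeddings
  `y, y′ : T₁ → ℂ` with `v(y) = α + β`, `v(y′) = α − β` and shadow values `w₁(y) = a`, `w₁(y′) = b`, all odd ⟹
  `cmFamilyRank Φ + 2 = cmTypeRank Φ₀ + cmTypeRank Φ₁ + 1`: `Hg(A₀ × A₁) = Hg(A₀) × Hg(A₁)`.  At ODD indices
  `[K_{i₁}:T₁]` the values `a, b` are automatically odd (gen 68 P2), and the certificate is uniform in the odd type cosets.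

## References

* [Gordon1999HodgeAVSurvey] B. B. Gordon, *A survey of the Hodge conjecture for abelian varieties*, §3 Theorem, 7.5–7.7,
  9.4.3.
* [Serre1977] J.-P. Serre, *Linear Representations of Finite Groups*, GTM 42, §2.2.
* [Shimura1998] G. Shimura, *Abelian Varieties with Complex Multiplication and Modular Functions*, §8.1, §18.1.
-/

set_option autoImplicit false

noncomputable section

open scoped BigOperators Classical

open CategoryTheory CategoryTheory.Limits NumberField Module IntermediateField

namespace Summit.HodgeConjecture.CorCM

open Literature.NumberTheory.ComplexMultiplication
open Literature.AlgebraicGeometry.Motives (AbelianVariety CMType)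
open Literature.AlgebraicGeometry.Motives.AbelianVariety
open Literature.AlgebraicGeometry.HodgeTheory
open Literature.AlgebraicGeometry.ComplexMultiplication (IsCMTypeRealisation)
open Literature.AlgebraicGeometry.Pohlmann1968

variable {I : Type} [Fintype I] {K : I → Type} [∀ i, Field (K i)] [∀ i, NumberField (K i)] [∀ i, IsCMField (K i)]
  {T₀ : Type} [Field T₀] [NumberField T₀] [IsCMField T₀] {T₁ : Type} [Field T₁] [NumberField T₁] [IsCMField T₁]

/-- **THE PARITY CERTIFICATE FOR CM FIELDS.**  (IRR) CM pivots `T₀ ⊆ K_{i₀}`, `T₁ ⊆ K_{i₁}` ⊇ traces, scalar commutant on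
`Anti(T₀)`, a reference equivariant injection `L₀ : Anti(T₁) → Anti(T₀)` (as a map `ℚ^{Hom(T₁,ℂ)} → ℚ^{Hom(T₀,ℂ)}`), a vector
`v ∈ Anti(T₁)` over the shadow `w₀` of `Φ_{i₀}` (`L₀ v = w₀`) and two embeddings `y, y′` with `v(y) = α + β`,
`v(y′) = α − β`, `w₁(y) = a`, `w₁(y′) = b`, `α, β, a, b` odd ⟹ `cmFamilyRank Φ + |I| = cmTypeRank Φ₀ + cmTypeRank Φ₁ + 1`
(`Hg(A₀ × A₁) = Hg(A₀) × Hg(A₁)`). [cite: Gordon1999HodgeAVSurvey, §3 Theorem, 7.5–7.7 and 9.4.3] [cite: Serre1977, §2.2] -/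
theorem cmFamilyRank_add_card_eq_of_parity_certificate {i₀ i₁ : I} (h01 : i₀ ≠ i₁) (hI : ∀ l, l = i₀ ∨ l = i₁)
    (Φ : ∀ i, CMType (K i)) [Algebra T₀ (K i₀)] [Algebra T₁ (K i₁)]
    (htr₀ : ∀ (a : K i₀ →+* ℂ) (k : K i₀), a k ∈ normalClosure ℚ (K i₁) ℂ → k ∈ Set.range (algebraMap T₀ (K i₀)))
    (htr₁ : ∀ (b : K i₁ →+* ℂ) (k : K i₁), b k ∈ normalClosure ℚ (K i₀) ℂ → k ∈ Set.range (algebraMap T₁ (K i₁)))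
    (hirr₀ : ∀ W : Submodule ℚ ((T₀ →+* ℂ) → ℚ), W ≤ antiWeights (E := T₀ →+* ℂ) (starRingAut : ℂ ≃+* ℂ) → W ≠ ⊥ →
      (∀ (k : ℂ ≃+* ℂ) (f : (T₀ →+* ℂ) → ℚ), f ∈ W → (fun y => f (k • y)) ∈ W) →
        W = antiWeights (E := T₀ →+* ℂ) (starRingAut : ℂ ≃+* ℂ))
    (hirr₁ : ∀ W : Submodule ℚ ((T₁ →+* ℂ) → ℚ), W ≤ antiWeights (E := T₁ →+* ℂ) (starRingAut : ℂ ≃+* ℂ) → W ≠ ⊥ →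
      (∀ (k : ℂ ≃+* ℂ) (f : (T₁ →+* ℂ) → ℚ), f ∈ W → (fun y => f (k • y)) ∈ W) →
        W = antiWeights (E := T₁ →+* ℂ) (starRingAut : ℂ ≃+* ℂ))
    (habs₀ : ∀ φ : ((T₀ →+* ℂ) → ℚ) →ₗ[ℚ] ((T₀ →+* ℂ) → ℚ),
      (∀ a ∈ antiWeights (E := T₀ →+* ℂ) (starRingAut : ℂ ≃+* ℂ), φ a ∈ antiWeights (E := T₀ →+* ℂ) (starRingAut : ℂ ≃+* ℂ)) →
      (∀ (k : ℂ ≃+* ℂ) (a : (T₀ →+* ℂ) → ℚ), a ∈ antiWeights (E := T₀ →+* ℂ) (starRingAut : ℂ ≃+* ℂ) →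
        φ (fun y => a (k • y)) = fun y => φ a (k • y)) →
      ∃ t : ℚ, ∀ a ∈ antiWeights (E := T₀ →+* ℂ) (starRingAut : ℂ ≃+* ℂ), φ a = t • a)
    (L₀ : ((T₁ →+* ℂ) → ℚ) →ₗ[ℚ] ((T₀ →+* ℂ) → ℚ))
    (hL₀A : ∀ f ∈ antiWeights (E := T₁ →+* ℂ) (starRingAut : ℂ ≃+* ℂ),
      L₀ f ∈ antiWeights (E := T₀ →+* ℂ) (starRingAut : ℂ ≃+* ℂ))
    (hL₀inj : ∀ f ∈ antiWeights (E := T₁ →+* ℂ) (starRingAut : ℂ ≃+* ℂ), L₀ f = 0 → f = 0)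
    (hL₀eq : ∀ (k : ℂ ≃+* ℂ) (f : (T₁ →+* ℂ) → ℚ), f ∈ antiWeights (E := T₁ →+* ℂ) (starRingAut : ℂ ≃+* ℂ) →
      L₀ (fun y => f (k • y)) = fun y => L₀ f (k • y))
    {v : (T₁ →+* ℂ) → ℚ} (hv : v ∈ antiWeights (E := T₁ →+* ℂ) (starRingAut : ℂ ≃+* ℂ))
    (hL₀v : L₀ v = fun y : T₀ →+* ℂ => ∑ t ∈ Finset.univ.filter (fun t : K i₀ →+* ℂ =>
      t.comp (algebraMap T₀ (K i₀)) = y), antiVec (Φ i₀).1 (1 : ℂ ≃+* ℂ) t)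
    (y y' : T₁ →+* ℂ) {α β a b : ℤ} (hα : Odd α) (hβ : Odd β) (ha : Odd a) (hb : Odd b)
    (hvy : v y = α + β) (hvy' : v y' = α - β)
    (hay : ∑ t ∈ Finset.univ.filter (fun t : K i₁ →+* ℂ => t.comp (algebraMap T₁ (K i₁)) = y),
      antiVec (Φ i₁).1 (1 : ℂ ≃+* ℂ) t = a)
    (hby : ∑ t ∈ Finset.univ.filter (fun t : K i₁ →+* ℂ => t.comp (algebraMap T₁ (K i₁)) = y'),
      antiVec (Φ i₁).1 (1 : ℂ ≃+* ℂ) t = b) :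
    CMAlgebra.cmFamilyRank Φ + Fintype.card I = (∑ i, cmTypeRank (Φ i)) + 1 := by
  haveI : ∀ i, Nonempty (K i →+* ℂ) := fun i => inferInstance
  exact IrrOdd.typeRank_sigmaType_add_card_eq_of_parity_certificate' (G := ℂ ≃+* ℂ)
    (E := fun i => K i →+* ℂ) (Φ := fun i => (Φ i).1) (fun i => isCMTypeWith_conj (Φ i)) hI h01
    (fun t : K i₀ →+* ℂ => t.comp (algebraMap T₀ (K i₀))) (fun t : K i₁ →+* ℂ => t.comp (algebraMap T₁ (K i₁)))
    (fun _ _ => rfl) (fun _ _ => rfl) (exists_stab_smul_eq_of_comp_eq_of_trace_le i₁ htr₀)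
    (exists_stab_smul_eq_of_comp_eq_of_trace_le i₀ htr₁)
    comp_smul_mem_antiWeights_ringHom hirr₀ comp_smul_mem_antiWeights_ringHom hirr₁ habs₀
    (shadow_comp_algebraMap_mem_antiWeights (Φ i₀)) (shadow_comp_algebraMap_mem_antiWeights (Φ i₁))
    L₀ hL₀A hL₀inj hL₀eq hv hL₀v y y' hα hβ ha hb hvy hvy' hay hby

end Summit.HodgeConjecture.CorCM

end
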